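/-
Copyright (c) 2026 the pub-hodgecm-mathlib formalisation cell (harness21).  Prover seat hodgecm-mathlib-K2Liu-p02 (g5), Track B «K2-LIT» ∕ hLiu418
#184♮, Road I v3, organ U2f (LEAD F0P6-plan (g12∕g13) «M-156d» (3b), M-157c (3)).  2026-09-04.
-/
import Summits.HodgeConjecture.HodgeConjecture.Theorems.K2LiuRigidityDomainKFinite      -- ★ p858720 U2f (⇒) `finiteDimensional_span_orbit_of_mem_span_tmul`
import Summits.HodgeConjecture.HodgeConjecture.Theorems.K2LiuTensorEmbPlaceComponents    -- ★ `archPart_tensorEmb_eq_one`, `evalPlace_finPart_tensorEmb_eq_one`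
import Literature.NumberTheory.K2Lit.SiegelStandardIwasawaData                          -- ★ `IwasawaDatum.IsStd.exists_arch ∕ exists_fin`
import HarnessLib

/-!
# K2_Liu road (hLiu418 = stmt-HodgeConjecture-24832), Road I v3 organ U2f, bookkeeping: ARCHIMEDEAN AND FINITE PARTS THROUGH THE TENSOR EMBEDDING
# `h ↦ h ⊗ 1_{V′}`, and U2f's arch-stability hypothesis `hV` READ ON THE SMALL GROUP's `C_∞` for a STANDARD Iwasawa datum

Cell `pub/hodgecm-mathlib` (D-0151), Track B, build stream 29; binder sheet `K2/K2E5-plan/g6/SIGS-RoadI-v3.md` §2 U2f.  ★ p858720 (`K2LiuRigidityDomainKFinite`, H3) discharges #42F′'s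
`_hΦ` on the rigidity domain from ONE arch input `hV : ∀ k ∈ 𝒦.K, ∀ a ∈ V, ∃ a′ ∈ V, ∀ Φ_f, ω(s^B((tensorEmb k)_∞, 1)) E(a ⊗ Φ_f) = E(a′ ⊗ Φ_f)`, phrased through the
archimedean part of the BIG group.  The consumer (U5's hol cut, `V = ℂ·Gaussian`) knows the arch action of the SMALL group's `C_∞` (★ `IwasawaDatum.IsStd`: `𝒦.K = C_∞·C_f`).
This file supplies the dictionary (★ `archToAdelic_mul_finAdelicToAdelic`, ★ `archPart_tensorEmb_eq_one`, ★ `evalPlace_finPart_tensorEmb_eq_one` + ★ `eq_of_forall_evalPlace_eq`):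

* §1 `finPart_tensorEmb_eq_one` (`h_f = 1 ⇒ (h ⊗ 1)_f = 1`); `tensorEmb_finAdelicToAdelic` ∕ `tensorEmb_archToAdelic` (`(1,u) ⊗ 1 = (1, ((1,u) ⊗ 1)_f)`, `(a,1) ⊗ 1 = (((a,1) ⊗ 1)_∞, 1)`);
  `archPart_tensorEmb` ∕ `finPart_tensorEmb` (`(k ⊗ 1)_∞ = ((k_∞,1) ⊗ 1)_∞`, `(k ⊗ 1)_f = ((1,k_f) ⊗ 1)_f`); **`archToAdelic_archPart_tensorEmb`**: `((k ⊗ 1)_∞, 1) = (k_∞, 1) ⊗ 1` and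
  **`finAdelicToAdelic_finPart_tensorEmb`**: `(1, (k ⊗ 1)_f) = (1, k_f) ⊗ 1` — the tensor embedding COMMUTES with the passage to archimedean ∕ finite parts;
* §2 (standard data) `IsStd.archToAdelic_archPart_mem` ∕ `IsStd.finAdelicToAdelic_finPart_mem` (`(k_∞,1), (1,k_f) ∈ 𝒦.K` for `k ∈ 𝒦.K`); **`hV_of_arch`** — U2f's `hV` follows from its
  restriction to the purely archimedean elements `(a_∞, 1) ∈ 𝒦.K`: `∀ a_∞, (a_∞,1) ∈ 𝒦.K → ∀ a ∈ V, ∃ a′ ∈ V, ∀ Φ_f, ω(s^B((a_∞,1) ⊗ 1)) E(a ⊗ Φ_f) = E(a′ ⊗ Φ_f)`; and the packaged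
  **`finiteDimensional_span_orbit_of_mem_span_tmul_of_isStd`** = ★ H3 with that hypothesis (`_hΦ` for the rigidity domain of a STANDARD datum from the `C_∞`-stability of `V` alone).

No definition, no instance, no named fact, no `sorry`; axioms ⊆ {propext, Classical.choice, Quot.sound}.  Products are typed in `H(𝔸) = HA` and assembled in term mode (the adelic
datum's instances agree with `HA`'s up to unfolding; cf. ★ `DoubledWeilUniqueness`).  HONEST LABEL: HC_CM is proved only modulo the 7 printed citations (2 remaining named inputs:
hLiu418 = stmt-HodgeConjecture-24832, h413 = stmt-HodgeConjecture-24833) until rung 0 closes; `--supports stmt-HodgeConjecture-24832` helper, count-neutral.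
References: [BorelJacquet1979] A. Borel, H. Jacquet, PSPM 33.1 (1979), §4.1 (`g = g_∞ g_f`); [Kudla1994] S. Kudla, Israel J. Math. 87 (1994), §2 (doubled space, `h ⊗ 1`);
[HarrisKudlaSweet1996] M. Harris, S. Kudla, W. J. Sweet, J. AMS 9 (1996), §1 (1.8), (1.15)–(1.17); [Tan1999] V. Tan, §1 p. 166; [PlatonovRapinchuk1994] §5.1.
-/

set_option autoImplicit false
set_option linter.dupNamespace false
set_option Elab.async false

noncomputable section

open scoped Matrix TensorProduct SchwartzMap Classical
open NumberField NumberField.mixedEmbedding IsDedekindDomain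

namespace Summit.HodgeConjecture.HodgeConjecture.Cruxes.HLiu418.K2LiuTensorEmbArchFinParts

open Literature.NumberTheory.Automorphic Literature.NumberTheory.Automorphic.UnitaryGroup
open Literature.NumberTheory.GaloisRepresentations
open Literature.NumberTheory.GelbartRogawski1991 Literature.NumberTheory.GelbartRogawski1991.UnitaryDualPair
open Literature.NumberTheory.GelbartRogawski1991.GRConstruction
open Literature.NumberTheory.Weil1964
open Literature.NumberTheory.K2Lit.SiegelDoubled
open Summit.HodgeConjecture.HodgeConjecture.Cruxes.HLiu418.K2LiuTensorEmbPlaceComponents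
open Summit.HodgeConjecture.HodgeConjecture.Cruxes.HLiu418.K2LiuRigidityDomainKFinite

variable (L : Type) [Field L] [NumberField L] [IsCMField L]
variable {N M n : ℕ} (e : Fin N × Fin M ≃ Fin n)
  (dV : Fin N → L) (hdV : ∀ i, IsCMField.complexConj L (dV i) = dV i)
  (dW : Fin M → L) (hdW : ∀ i, IsCMField.complexConj L (dW i) = dW i)
variable {M₂ M' n' : ℕ} (eW : Fin M × Fin M₂ ≃ Fin M') (e' : Fin N × Fin M' ≃ Fin n')
  (dV' : Fin M₂ → L) (hdV' : ∀ k, IsCMField.complexConj L (dV' k) = dV' k)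

/-! ## §1 The tensor embedding commutes with archimedean ∕ finite parts -/

/-- **`h_f = 1 ⇒ (h ⊗ 1)_f = 1`** (place by place ★ `evalPlace_finPart_tensorEmb_eq_one`, assembled by ★ `eq_of_forall_evalPlace_eq`). [cite: BorelJacquet1979, §4.1]
[cite: PlatonovRapinchuk1994, §5.1] -/
theorem finPart_tensorEmb_eq_one (h : HA L e dV hdV dW hdW)
    (h₁ : UnitaryGroup.finPart (Fp L) L (IsCMField.complexConj L) (n + n) (hermD L e dV hdV dW hdW) h = 1) :
    UnitaryGroup.finPart (Fp L) L (IsCMField.complexConj L) (n' + n') (hermD L e' dV hdV (tensorFrame L dW eW dV') (tensorFrame_real L dW hdW eW dV' hdV'))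
      (tensorEmb L e dV hdV dW hdW eW e' dV' hdV' h) = 1 :=
  UnitaryGroup.eq_of_forall_evalPlace_eq _ _ _ _ _ fun w =>
    (evalPlace_finPart_tensorEmb_eq_one L e dV hdV dW hdW eW e' dV' hdV' w h (by rw [h₁, map_one])).trans (map_one _).symm

/-- **`(1, u) ⊗ 1 = (1, ((1,u) ⊗ 1)_f)`**: the tensor embedding of a finite-adelic element is finite-adelic (★ `archPart_tensorEmb_eq_one`, ★ `archToAdelic_mul_finAdelicToAdelic`).
[cite: BorelJacquet1979, §4.1] [cite: Kudla1994, §2] -/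
theorem tensorEmb_finAdelicToAdelic (u : UnitaryGroup.finAdelic (Fp L) L (IsCMField.complexConj L) (n + n) (hermD L e dV hdV dW hdW)) :
    tensorEmb L e dV hdV dW hdW eW e' dV' hdV' (UnitaryGroup.finAdelicToAdelic (Fp L) L (IsCMField.complexConj L) (n + n) (hermD L e dV hdV dW hdW) u) =
      UnitaryGroup.finAdelicToAdelic (Fp L) L (IsCMField.complexConj L) (n' + n') (hermD L e' dV hdV (tensorFrame L dW eW dV') (tensorFrame_real L dW hdW eW dV' hdV'))
        (UnitaryGroup.finPart (Fp L) L (IsCMField.complexConj L) (n' + n') (hermD L e' dV hdV (tensorFrame L dW eW dV') (tensorFrame_real L dW hdW eW dV' hdV'))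
          (tensorEmb L e dV hdV dW hdW eW e' dV' hdV' (UnitaryGroup.finAdelicToAdelic (Fp L) L (IsCMField.complexConj L) (n + n) (hermD L e dV hdV dW hdW) u))) := by
  have h1 := archPart_tensorEmb_eq_one L e dV hdV dW hdW eW e' dV' hdV'
    (UnitaryGroup.finAdelicToAdelic (Fp L) L (IsCMField.complexConj L) (n + n) (hermD L e dV hdV dW hdW) u)
    (UnitaryGroup.archPart_finAdelicToAdelic (Fp L) L (IsCMField.complexConj L) (n + n) (hermD L e dV hdV dW hdW) u)
  have h := UnitaryGroup.archToAdelic_mul_finAdelicToAdelic (Fp L) L (IsCMField.complexConj L) (n' + n')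
    (hermD L e' dV hdV (tensorFrame L dW eW dV') (tensorFrame_real L dW hdW eW dV' hdV'))
    (tensorEmb L e dV hdV dW hdW eW e' dV' hdV' (UnitaryGroup.finAdelicToAdelic (Fp L) L (IsCMField.complexConj L) (n + n) (hermD L e dV hdV dW hdW) u))
  rw [h1, map_one, one_mul] at h
  exact h.symm

/-- **`(a, 1) ⊗ 1 = (((a,1) ⊗ 1)_∞, 1)`**: the tensor embedding of an archimedean element is archimedean (§1 `finPart_tensorEmb_eq_one`, ★ `archToAdelic_mul_finAdelicToAdelic`).
[cite: BorelJacquet1979, §4.1] [cite: Kudla1994, §2] -/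
theorem tensorEmb_archToAdelic (a : UnitaryGroup.arch (Fp L) L (IsCMField.complexConj L) (n + n) (hermD L e dV hdV dW hdW)) :
    tensorEmb L e dV hdV dW hdW eW e' dV' hdV' (UnitaryGroup.archToAdelic (Fp L) L (IsCMField.complexConj L) (n + n) (hermD L e dV hdV dW hdW) a) =
      UnitaryGroup.archToAdelic (Fp L) L (IsCMField.complexConj L) (n' + n') (hermD L e' dV hdV (tensorFrame L dW eW dV') (tensorFrame_real L dW hdW eW dV' hdV'))
        (UnitaryGroup.archPart (Fp L) L (IsCMField.complexConj L) (n' + n') (hermD L e' dV hdV (tensorFrame L dW eW dV') (tensorFrame_real L dW hdW eW dV' hdV'))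
          (tensorEmb L e dV hdV dW hdW eW e' dV' hdV' (UnitaryGroup.archToAdelic (Fp L) L (IsCMField.complexConj L) (n + n) (hermD L e dV hdV dW hdW) a))) := by
  have h1 := finPart_tensorEmb_eq_one L e dV hdV dW hdW eW e' dV' hdV'
    (UnitaryGroup.archToAdelic (Fp L) L (IsCMField.complexConj L) (n + n) (hermD L e dV hdV dW hdW) a)
    (UnitaryGroup.finPart_archToAdelic (Fp L) L (IsCMField.complexConj L) (n + n) (hermD L e dV hdV dW hdW) a)
  have h := UnitaryGroup.archToAdelic_mul_finAdelicToAdelic (Fp L) L (IsCMField.complexConj L) (n' + n')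
    (hermD L e' dV hdV (tensorFrame L dW eW dV') (tensorFrame_real L dW hdW eW dV' hdV'))
    (tensorEmb L e dV hdV dW hdW eW e' dV' hdV' (UnitaryGroup.archToAdelic (Fp L) L (IsCMField.complexConj L) (n + n) (hermD L e dV hdV dW hdW) a))
  rw [h1, map_one, mul_one] at h
  exact h.symm

/-- **`(k ⊗ 1)_∞ = ((k_∞, 1) ⊗ 1)_∞`**: the archimedean part of `k ⊗ 1` only sees `k_∞` (`k = (k_∞,1)(1,k_f)`, ★ `archPart_tensorEmb_eq_one` on the second factor; term mode over
the product re-typed in `H(𝔸)`). [cite: BorelJacquet1979, §4.1] [cite: Kudla1994, §2] -/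
theorem archPart_tensorEmb (k : HA L e dV hdV dW hdW) :
    UnitaryGroup.archPart (Fp L) L (IsCMField.complexConj L) (n' + n') (hermD L e' dV hdV (tensorFrame L dW eW dV') (tensorFrame_real L dW hdW eW dV' hdV'))
        (tensorEmb L e dV hdV dW hdW eW e' dV' hdV' k) =
      UnitaryGroup.archPart (Fp L) L (IsCMField.complexConj L) (n' + n') (hermD L e' dV hdV (tensorFrame L dW eW dV') (tensorFrame_real L dW hdW eW dV' hdV'))
        (tensorEmb L e dV hdV dW hdW eW e' dV' hdV'
          (UnitaryGroup.archToAdelic (Fp L) L (IsCMField.complexConj L) (n + n) (hermD L e dV hdV dW hdW)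
            (UnitaryGroup.archPart (Fp L) L (IsCMField.complexConj L) (n + n) (hermD L e dV hdV dW hdW) k))) := by
  -- `k = (k_∞, 1) · (1, k_f)`, re-typed in `H(𝔸) = HA`
  have hk : (UnitaryGroup.archToAdelic (Fp L) L (IsCMField.complexConj L) (n + n) (hermD L e dV hdV dW hdW)
        (UnitaryGroup.archPart (Fp L) L (IsCMField.complexConj L) (n + n) (hermD L e dV hdV dW hdW) k) : HA L e dV hdV dW hdW) *
      (UnitaryGroup.finAdelicToAdelic (Fp L) L (IsCMField.complexConj L) (n + n) (hermD L e dV hdV dW hdW)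
        (UnitaryGroup.finPart (Fp L) L (IsCMField.complexConj L) (n + n) (hermD L e dV hdV dW hdW) k) : HA L e dV hdV dW hdW) = k :=
    UnitaryGroup.archToAdelic_mul_finAdelicToAdelic (Fp L) L (IsCMField.complexConj L) (n + n) (hermD L e dV hdV dW hdW) k
  have h1 := archPart_tensorEmb_eq_one L e dV hdV dW hdW eW e' dV' hdV'
    (UnitaryGroup.finAdelicToAdelic (Fp L) L (IsCMField.complexConj L) (n + n) (hermD L e dV hdV dW hdW)
      (UnitaryGroup.finPart (Fp L) L (IsCMField.complexConj L) (n + n) (hermD L e dV hdV dW hdW) k))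
    (UnitaryGroup.archPart_finAdelicToAdelic (Fp L) L (IsCMField.complexConj L) (n + n) (hermD L e dV hdV dW hdW) _)
  exact (congrArg (fun x => UnitaryGroup.archPart (Fp L) L (IsCMField.complexConj L) (n' + n')
      (hermD L e' dV hdV (tensorFrame L dW eW dV') (tensorFrame_real L dW hdW eW dV' hdV')) (tensorEmb L e dV hdV dW hdW eW e' dV' hdV' x)) hk).symm.trans
    (((congrArg (fun y => UnitaryGroup.archPart (Fp L) L (IsCMField.complexConj L) (n' + n')
        (hermD L e' dV hdV (tensorFrame L dW eW dV') (tensorFrame_real L dW hdW eW dV' hdV')) y) (map_mul (tensorEmb L e dV hdV dW hdW eW e' dV' hdV') _ _)).trans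
      (map_mul (UnitaryGroup.archPart (Fp L) L (IsCMField.complexConj L) (n' + n')
        (hermD L e' dV hdV (tensorFrame L dW eW dV') (tensorFrame_real L dW hdW eW dV' hdV'))) _ _)).trans
      ((congrArg (fun z => _ * z) h1).trans (mul_one _)))

/-- **`(k ⊗ 1)_f = ((1, k_f) ⊗ 1)_f`**: the finite part of `k ⊗ 1` only sees `k_f`. [cite: BorelJacquet1979, §4.1] [cite: Kudla1994, §2] -/
theorem finPart_tensorEmb (k : HA L e dV hdV dW hdW) :
    UnitaryGroup.finPart (Fp L) L (IsCMField.complexConj L) (n' + n') (hermD L e' dV hdV (tensorFrame L dW eW dV') (tensorFrame_real L dW hdW eW dV' hdV'))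
        (tensorEmb L e dV hdV dW hdW eW e' dV' hdV' k) =
      UnitaryGroup.finPart (Fp L) L (IsCMField.complexConj L) (n' + n') (hermD L e' dV hdV (tensorFrame L dW eW dV') (tensorFrame_real L dW hdW eW dV' hdV'))
        (tensorEmb L e dV hdV dW hdW eW e' dV' hdV'
          (UnitaryGroup.finAdelicToAdelic (Fp L) L (IsCMField.complexConj L) (n + n) (hermD L e dV hdV dW hdW)
            (UnitaryGroup.finPart (Fp L) L (IsCMField.complexConj L) (n + n) (hermD L e dV hdV dW hdW) k))) := by
  have hk : (UnitaryGroup.archToAdelic (Fp L) L (IsCMField.complexConj L) (n + n) (hermD L e dV hdV dW hdW)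
        (UnitaryGroup.archPart (Fp L) L (IsCMField.complexConj L) (n + n) (hermD L e dV hdV dW hdW) k) : HA L e dV hdV dW hdW) *
      (UnitaryGroup.finAdelicToAdelic (Fp L) L (IsCMField.complexConj L) (n + n) (hermD L e dV hdV dW hdW)
        (UnitaryGroup.finPart (Fp L) L (IsCMField.complexConj L) (n + n) (hermD L e dV hdV dW hdW) k) : HA L e dV hdV dW hdW) = k :=
    UnitaryGroup.archToAdelic_mul_finAdelicToAdelic (Fp L) L (IsCMField.complexConj L) (n + n) (hermD L e dV hdV dW hdW) k
  have h1 := finPart_tensorEmb_eq_one L e dV hdV dW hdW eW e' dV' hdV'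
    (UnitaryGroup.archToAdelic (Fp L) L (IsCMField.complexConj L) (n + n) (hermD L e dV hdV dW hdW)
      (UnitaryGroup.archPart (Fp L) L (IsCMField.complexConj L) (n + n) (hermD L e dV hdV dW hdW) k))
    (UnitaryGroup.finPart_archToAdelic (Fp L) L (IsCMField.complexConj L) (n + n) (hermD L e dV hdV dW hdW) _)
  exact (congrArg (fun x => UnitaryGroup.finPart (Fp L) L (IsCMField.complexConj L) (n' + n')
      (hermD L e' dV hdV (tensorFrame L dW eW dV') (tensorFrame_real L dW hdW eW dV' hdV')) (tensorEmb L e dV hdV dW hdW eW e' dV' hdV' x)) hk).symm.trans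
    (((congrArg (fun y => UnitaryGroup.finPart (Fp L) L (IsCMField.complexConj L) (n' + n')
        (hermD L e' dV hdV (tensorFrame L dW eW dV') (tensorFrame_real L dW hdW eW dV' hdV')) y) (map_mul (tensorEmb L e dV hdV dW hdW eW e' dV' hdV') _ _)).trans
      (map_mul (UnitaryGroup.finPart (Fp L) L (IsCMField.complexConj L) (n' + n')
        (hermD L e' dV hdV (tensorFrame L dW eW dV') (tensorFrame_real L dW hdW eW dV' hdV'))) _ _)).trans
      ((congrArg (fun z => z * _) h1).trans (one_mul _)))

/-- **THE TENSOR EMBEDDING COMMUTES WITH THE ARCHIMEDEAN PART**: `(((k ⊗ 1)_∞), 1) = (k_∞, 1) ⊗ 1` in `H_big(𝔸)`. [cite: BorelJacquet1979, §4.1] [cite: Kudla1994, §2]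
[cite: HarrisKudlaSweet1996, §1 (1.8)] -/
theorem archToAdelic_archPart_tensorEmb (k : HA L e dV hdV dW hdW) :
    UnitaryGroup.archToAdelic (Fp L) L (IsCMField.complexConj L) (n' + n') (hermD L e' dV hdV (tensorFrame L dW eW dV') (tensorFrame_real L dW hdW eW dV' hdV'))
        (UnitaryGroup.archPart (Fp L) L (IsCMField.complexConj L) (n' + n') (hermD L e' dV hdV (tensorFrame L dW eW dV') (tensorFrame_real L dW hdW eW dV' hdV'))
          (tensorEmb L e dV hdV dW hdW eW e' dV' hdV' k)) =
      tensorEmb L e dV hdV dW hdW eW e' dV' hdV'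
        (UnitaryGroup.archToAdelic (Fp L) L (IsCMField.complexConj L) (n + n) (hermD L e dV hdV dW hdW)
          (UnitaryGroup.archPart (Fp L) L (IsCMField.complexConj L) (n + n) (hermD L e dV hdV dW hdW) k)) :=
  (congrArg (fun x => UnitaryGroup.archToAdelic (Fp L) L (IsCMField.complexConj L) (n' + n')
      (hermD L e' dV hdV (tensorFrame L dW eW dV') (tensorFrame_real L dW hdW eW dV' hdV')) x)
    (archPart_tensorEmb L e dV hdV dW hdW eW e' dV' hdV' k)).trans
    (tensorEmb_archToAdelic L e dV hdV dW hdW eW e' dV' hdV' _).symm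

/-- **THE TENSOR EMBEDDING COMMUTES WITH THE FINITE PART**: `(1, (k ⊗ 1)_f) = (1, k_f) ⊗ 1` in `H_big(𝔸)`. [cite: BorelJacquet1979, §4.1] [cite: Kudla1994, §2]
[cite: HarrisKudlaSweet1996, §1 (1.8)] -/
theorem finAdelicToAdelic_finPart_tensorEmb (k : HA L e dV hdV dW hdW) :
    UnitaryGroup.finAdelicToAdelic (Fp L) L (IsCMField.complexConj L) (n' + n') (hermD L e' dV hdV (tensorFrame L dW eW dV') (tensorFrame_real L dW hdW eW dV' hdV'))
        (UnitaryGroup.finPart (Fp L) L (IsCMField.complexConj L) (n' + n') (hermD L e' dV hdV (tensorFrame L dW eW dV') (tensorFrame_real L dW hdW eW dV' hdV'))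
          (tensorEmb L e dV hdV dW hdW eW e' dV' hdV' k)) =
      tensorEmb L e dV hdV dW hdW eW e' dV' hdV'
        (UnitaryGroup.finAdelicToAdelic (Fp L) L (IsCMField.complexConj L) (n + n) (hermD L e dV hdV dW hdW)
          (UnitaryGroup.finPart (Fp L) L (IsCMField.complexConj L) (n + n) (hermD L e dV hdV dW hdW) k)) :=
  (congrArg (fun x => UnitaryGroup.finAdelicToAdelic (Fp L) L (IsCMField.complexConj L) (n' + n')
      (hermD L e' dV hdV (tensorFrame L dW eW dV') (tensorFrame_real L dW hdW eW dV' hdV')) x)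
    (finPart_tensorEmb L e dV hdV dW hdW eW e' dV' hdV' k)).trans
    (tensorEmb_finAdelicToAdelic L e dV hdV dW hdW eW e' dV' hdV' _).symm

/-! ## §2 Standard data: `(k_∞, 1) ∈ 𝒦.K`, and U2f's `hV` read on the small group's archimedean elements -/

/-- for a STANDARD datum, `(k_∞, 1) ∈ 𝒦.K` whenever `k ∈ 𝒦.K` (★ `IsStd.exists_arch`). [cite: BorelJacquet1979, §4.1] [cite: Tan1999, §1 p. 166] -/
theorem IsStd.archToAdelic_archPart_mem {𝒦 : IwasawaDatum L e dV hdV dW hdW} (h𝒦 : 𝒦.IsStd) {k : HA L e dV hdV dW hdW} (hk : k ∈ 𝒦.K) :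
    (UnitaryGroup.archToAdelic (Fp L) L (IsCMField.complexConj L) (n + n) (hermD L e dV hdV dW hdW)
      (UnitaryGroup.archPart (Fp L) L (IsCMField.complexConj L) (n + n) (hermD L e dV hdV dW hdW) k) : HA L e dV hdV dW hdW) ∈ 𝒦.K := by
  obtain ⟨Cinf, S, -, -, hCK, hKC⟩ := h𝒦.exists_arch
  exact hCK _ (hKC k hk)

/-- for a STANDARD datum, `(1, k_f) ∈ 𝒦.K` whenever `k ∈ 𝒦.K` (★ `IsStd.exists_fin`). [cite: BorelJacquet1979, §4.1] [cite: Tan1999, §1 p. 166] -/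
theorem IsStd.finAdelicToAdelic_finPart_mem {𝒦 : IwasawaDatum L e dV hdV dW hdW} (h𝒦 : 𝒦.IsStd) {k : HA L e dV hdV dW hdW} (hk : k ∈ 𝒦.K) :
    (UnitaryGroup.finAdelicToAdelic (Fp L) L (IsCMField.complexConj L) (n + n) (hermD L e dV hdV dW hdW)
      (UnitaryGroup.finPart (Fp L) L (IsCMField.complexConj L) (n + n) (hermD L e dV hdV dW hdW) k) : HA L e dV hdV dW hdW) ∈ 𝒦.K := by
  obtain ⟨Cfin, -, hCK, hKC⟩ := h𝒦.exists_fin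
  exact hCK _ (hKC k hk)

variable {sB : HA L e' dV hdV (tensorFrame L dW eW dV') (tensorFrame_real L dW hdW eW dV' hdV') →*
    MpD L e' dV hdV (tensorFrame L dW eW dV') (tensorFrame_real L dW hdW eW dV' hdV')}

set_option maxHeartbeats 2000000 in -- the big datum's carrier telescope
/-- **U2f's `hV` FROM THE ARCHIMEDEAN ELEMENTS OF THE SMALL GROUP** (standard datum): if every purely archimedean `(a_∞, 1) ∈ 𝒦.K` maps `V` into `V` slot-wise
(`∀ a ∈ V, ∃ a′ ∈ V, ∀ Φ_f, ω(s^B((a_∞,1) ⊗ 1)) E(a ⊗ Φ_f) = E(a′ ⊗ Φ_f)`), then `hV` of ★ `finiteDimensional_span_orbit_of_mem_span_tmul` holds (§1 `archToAdelic_archPart_tensorEmb` +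
`IsStd.archToAdelic_archPart_mem`).  No hypothesis on `s^B`. [cite: HarrisKudlaSweet1996, §1 (1.15)–(1.17)] [cite: BorelJacquet1979, §4.1] -/
theorem hV_of_arch {𝒦 : IwasawaDatum L e dV hdV dW hdW} (h𝒦 : 𝒦.IsStd) (V : Submodule ℂ 𝓢(((Fin (n' + n')) → mixedSpace (Fp L)), ℂ))
    (harch : ∀ ainf : UnitaryGroup.arch (Fp L) L (IsCMField.complexConj L) (n + n) (hermD L e dV hdV dW hdW),
      (UnitaryGroup.archToAdelic (Fp L) L (IsCMField.complexConj L) (n + n) (hermD L e dV hdV dW hdW) ainf : HA L e dV hdV dW hdW) ∈ 𝒦.K →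
      ∀ a ∈ V, ∃ a' ∈ V, ∀ f : FinSB (Fp L) (Fin (n' + n')),
        adelicMpCont.omega (Fp L) (Fin (n' + n')) (gramDA L e' dV hdV (tensorFrame L dW eW dV') (tensorFrame_real L dW hdW eW dV' hdV'))
            (sB (tensorEmb L e dV hdV dW hdW eW e' dV' hdV'
              (UnitaryGroup.archToAdelic (Fp L) L (IsCMField.complexConj L) (n + n) (hermD L e dV hdV dW hdW) ainf)))
            (piSchwartzBruhatEquiv (Fp L) (Fin (n' + n')) (a ⊗ₜ[ℂ] f)) =
          piSchwartzBruhatEquiv (Fp L) (Fin (n' + n')) (a' ⊗ₜ[ℂ] f)) :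
    ∀ k ∈ 𝒦.K, ∀ a ∈ V, ∃ a' ∈ V, ∀ f : FinSB (Fp L) (Fin (n' + n')),
      adelicMpCont.omega (Fp L) (Fin (n' + n')) (gramDA L e' dV hdV (tensorFrame L dW eW dV') (tensorFrame_real L dW hdW eW dV' hdV'))
          (sB (UnitaryGroup.archToAdelic (Fp L) L (IsCMField.complexConj L) (n' + n')
            (hermD L e' dV hdV (tensorFrame L dW eW dV') (tensorFrame_real L dW hdW eW dV' hdV'))
            (UnitaryGroup.archPart (Fp L) L (IsCMField.complexConj L) (n' + n')
              (hermD L e' dV hdV (tensorFrame L dW eW dV') (tensorFrame_real L dW hdW eW dV' hdV'))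
              (tensorEmb L e dV hdV dW hdW eW e' dV' hdV' k))))
          (piSchwartzBruhatEquiv (Fp L) (Fin (n' + n')) (a ⊗ₜ[ℂ] f)) =
        piSchwartzBruhatEquiv (Fp L) (Fin (n' + n')) (a' ⊗ₜ[ℂ] f) := by
  intro k hk a ha
  obtain ⟨a', ha', h⟩ := harch _ (IsStd.archToAdelic_archPart_mem L e dV hdV dW hdW h𝒦 hk) a ha
  exact ⟨a', ha', fun f => (congrArg (fun x => adelicMpCont.omega (Fp L) (Fin (n' + n'))
      (gramDA L e' dV hdV (tensorFrame L dW eW dV') (tensorFrame_real L dW hdW eW dV' hdV')) (sB x)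
      (piSchwartzBruhatEquiv (Fp L) (Fin (n' + n')) (a ⊗ₜ[ℂ] f))) (archToAdelic_archPart_tensorEmb L e dV hdV dW hdW eW e' dV' hdV' k)).trans (h f)⟩

set_option maxHeartbeats 2000000 in -- the big datum's carrier telescope
/-- **U2f (⇒) FOR A STANDARD DATUM, ARCH INPUT ON THE SMALL GROUP ONLY**: ★ `finiteDimensional_span_orbit_of_mem_span_tmul` with `hV` replaced by the `C_∞`-statement
`harch` of `hV_of_arch` — the rigidity domain `V ⊗ 𝒮_f` satisfies #42F′'s `_hΦ` as soon as the purely archimedean elements of `𝒦.K` stabilise `V` slot-wise.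
[cite: HarrisKudlaSweet1996, §1 (1.15)–(1.17)] [cite: Tan1999, §1 p. 166] [cite: BorelJacquet1979, §4.1] -/
theorem finiteDimensional_span_orbit_of_mem_span_tmul_of_isStd (hdV0 : ∀ i, dV i ≠ 0) (hdW0 : ∀ i, dW i ≠ 0) (hdV'0 : ∀ k, dV' k ≠ 0)
    {𝒦 : IwasawaDatum L e dV hdV dW hdW} (h𝒦 : 𝒦.IsStd) {χb : HeckeCharacter L}
    (hsB : IsDoubledWeilRep L e' dV hdV hdV0 (tensorFrame L dW eW dV') (tensorFrame_real L dW hdW eW dV' hdV')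
      (tensorFrame_ne_zero L dW eW dV' hdW0 hdV'0) χb sB)
    (V : Submodule ℂ 𝓢(((Fin (n' + n')) → mixedSpace (Fp L)), ℂ)) [FiniteDimensional ℂ V]
    (harch : ∀ ainf : UnitaryGroup.arch (Fp L) L (IsCMField.complexConj L) (n + n) (hermD L e dV hdV dW hdW),
      (UnitaryGroup.archToAdelic (Fp L) L (IsCMField.complexConj L) (n + n) (hermD L e dV hdV dW hdW) ainf : HA L e dV hdV dW hdW) ∈ 𝒦.K →
      ∀ a ∈ V, ∃ a' ∈ V, ∀ f : FinSB (Fp L) (Fin (n' + n')),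
        adelicMpCont.omega (Fp L) (Fin (n' + n')) (gramDA L e' dV hdV (tensorFrame L dW eW dV') (tensorFrame_real L dW hdW eW dV' hdV'))
            (sB (tensorEmb L e dV hdV dW hdW eW e' dV' hdV'
              (UnitaryGroup.archToAdelic (Fp L) L (IsCMField.complexConj L) (n + n) (hermD L e dV hdV dW hdW) ainf)))
            (piSchwartzBruhatEquiv (Fp L) (Fin (n' + n')) (a ⊗ₜ[ℂ] f)) =
          piSchwartzBruhatEquiv (Fp L) (Fin (n' + n')) (a' ⊗ₜ[ℂ] f))
    {Φ : piSchwartzBruhat (Fp L) (Fin (n' + n'))}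
    (hΦ : Φ ∈ Submodule.span ℂ {x : piSchwartzBruhat (Fp L) (Fin (n' + n')) |
      ∃ a ∈ V, ∃ f : FinSB (Fp L) (Fin (n' + n')), x = piSchwartzBruhatEquiv (Fp L) (Fin (n' + n')) (a ⊗ₜ[ℂ] f)}) :
    FiniteDimensional ℂ (Submodule.span ℂ (Set.range fun k : 𝒦.K =>
      adelicMpCont.omega (Fp L) (Fin (n' + n')) (gramDA L e' dV hdV (tensorFrame L dW eW dV') (tensorFrame_real L dW hdW eW dV' hdV'))
        (sB (tensorEmb L e dV hdV dW hdW eW e' dV' hdV' (k : HA L e dV hdV dW hdW))) Φ)) :=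
  finiteDimensional_span_orbit_of_mem_span_tmul L e dV hdV hdV0 dW hdW hdW0 eW e' dV' hdV' hdV'0 𝒦 hsB V
    (hV_of_arch L e dV hdV dW hdW eW e' dV' hdV' h𝒦 V harch) hΦ

end Summit.HodgeConjecture.HodgeConjecture.Cruxes.HLiu418.K2LiuTensorEmbArchFinParts

end
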